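import Mathlib
import Summits.NavierStokesRegularity.NavierStokesRegularity.Theorems.EulerZoomLiouvillePowerGaugeEulerLiouvilleClockRigidityODE
import Summits.NavierStokesRegularity.NavierStokesRegularity.Theorems.EulerZoomLiouvillePowerGaugeEulerLiouvilleClockRigidityVorticity
import Literature.Analysis.FluidPDE.ClassicalSolution
import Literature.Analysis.FluidPDE.FlatSwirlGauge
import HarnessLib

/-!
# Clock rigidity for shape-preserving Euler flows, part 3: the profile equation and the trichotomy
# (crux `EulerZoomLiouville.PowerGaugeEulerLiouville` = stmt-NavierStokesRegularity-19832; line `logtime-breathers` of ns-idea-11, stub T1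
# `stub_clockRigidity` — member-level filler)

Route `EulerZoomLiouville` (NavierStokesRegularity); width seat ns-ezl-w4 on the interim LEAD ns-typeII-p2 g10's width offer (2026-08-28T06:34:58Z).
CLOCK RIGIDITY (the frame stub T1 of the line): in the window `0 < ρ ≤ ½`, a member of Seregin's power-gauged ancient Euler class that is a CLASSICAL
Euler solution on `(−∞,0) × ℝ³` and SHAPE-PRESERVING — `u(τ, y) = θ(τ) V(y/ℓ(τ))` for all `τ < 0`, with positive amplitude / length clocks differentiable
on `(−∞,0)` — is a LOG-TIME BREATHER (`u = e^{cτ} W(e^{−cτ} y)`, `c ≠ 0`), a POWER CLOCK about some `T₀ ≥ 0` (`u = (T₀−τ)^{γ−1} W((T₀−τ)^{−γ} y)`), or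
STEADY on the past.

Proof.  The profile `V = θ(−1)⁻¹ u(−1, ℓ(−1)·)` is smooth.  Substituting the ansatz into the momentum equation (`IsClassicalNSSolutionOn.momentum`;
time derivative by the chain rule, `(u·∇)u = (θ²/ℓ)(V·∇)V`, `∇p(ℓz) = ℓ⁻¹∇(p∘ℓ)(z)`) and multiplying by `ℓ/θ²` gives the PROFILE IDENTITY
`α(τ) V + β(τ) (z·∇)V + (V·∇)V = ∇q_τ`, `α = θ'ℓ/θ²`, `β = −ℓ'/θ`, `q_τ(z) = −θ⁻² p(τ, ℓz)` (`ClockRigidity.profile_identity`).  DICHOTOMY: if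
`(α, β)` is the same at all past times, the clocks solve `θ' = Aθ²/ℓ`, `ℓ' = Bθ` and `ClockRigidity.clock_trichotomy` (part 1) gives the three shapes,
each of which is rewritten into the breather / power-clock / steady form with the rescaled profile `W = m V(L⁻¹ ·)`; otherwise two times give a
degenerate relation `a V + b (z·∇)V = ∇Q`, `(a,b) ≠ (0,0)`, and `ClockRigidity.slice_eq_zero_of_degenerate` (part 2: curl homogeneity + the `E`-gauge,
then the `A`-gauge harmonic Liouville) gives `u(τ) = 0` for every `τ < 0` — steady with `v = 0`.  (Potential flows `m(τ)∇φ` show that the class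
hypothesis is needed: they are shape-preserving classical Euler flows with arbitrary clocks, excluded only by the gauges.)

* `ClockRigidity.gradient_const_mul'` — `∇(c f) = c ∇f` at a point of differentiability;
* `ClockRigidity.profile_identity` — the profile identity above, for every `τ < 0` and `z`;
* `ClockRigidity.clockRigidity_of_classical_shapePreserving` — **THE STUB**: `Sig.stub_clockRigidity` of `Cruxes/PowerGaugeEulerLiouville/Lines/
  logtime_breathers.lean` with `InClass` (weak-gradient and gauge components; the suitable-weak component is idle and not taken), `IsShapePreserving`,
  `IsLogtimeBreather`, `IsPowerClock`, `IsSteadyPast` UNFOLDED verbatim (Theorems files do not import Cruxes; the LEAD wires it by name: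
  `fun ρ hρ hρ2 u p H c hin hcl hsp => ClockRigidity.clockRigidity_of_classical_shapePreserving hρ hρ2 hin.2.1 hin.2.2 hcl hsp`).

WHAT THIS IS NOT: not NS, not E, not the crux — the classification frame (T1) of one line on the crux class 19832 (MODEL lattice); the breather (T2a/T2b
landed, T3 open), power-clock (T4 ⊇ the lead's self-similar residue) and shapeless (T5) strata are elsewhere / open; no summit statement is proved here.
[folklore]
-/

noncomputable section

-- flat `Theorems/<Route><Decl>…` files of one crux share the namespace of the crux (tree convention: `Summit.<S>.<S>.…`)
set_option linter.dupNamespace false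

open MeasureTheory Set Filter Topology Metric Function
open scoped NNReal ENNReal ContDiff

namespace Summit.NavierStokesRegularity.NavierStokesRegularity.Theorems.PowerGaugeEulerLiouville

open Literature.Analysis Literature.Analysis.FluidPDE

namespace ClockRigidity

/-! ### Gradient algebra -/

/-- `∇(c f)(z) = c ∇f(z)` for `f` differentiable at `z` (Mathlib's `fderiv_const_mul` through the Riesz isometry). [folklore] -/
theorem gradient_const_mul' {f : EuclideanSpace ℝ (Fin 3) → ℝ} {z : EuclideanSpace ℝ (Fin 3)} (hf : DifferentiableAt ℝ f z) (c : ℝ) :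
    gradient (fun y => c * f y) z = c • gradient f z := by
  unfold gradient
  rw [fderiv_const_mul hf c, map_smul]

/-! ### The profile identity -/

/-- **PROFILE IDENTITY of a shape-preserving classical Euler flow.**  If `(u, p)` is a classical Euler solution on `(−∞,0) × ℝ³` and
`u(τ, y) = θ(τ) V(y/ℓ(τ))` for `τ < 0` (positive clocks differentiable on `(−∞,0)`, `V` differentiable), then for every `τ < 0` and `z`,
`(θ'ℓ/θ²) V(z) − (ℓ'/θ) DV(z)[z] + DV(z)[V(z)] = ∇q_τ(z)` with `q_τ(y) = −θ(τ)⁻² p(τ, ℓ(τ) y)`: the momentum equation at the point `(τ, ℓz)`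
(time derivative of the ansatz by the chain rule — the one-sided `timeDerivWithin (Iio 0)` is the two-sided derivative at interior times —,
`(u·∇)u(ℓz) = (θ²/ℓ) DV(z)[V z]`, `∇p(τ)(ℓz) = ℓ⁻¹ ∇(p(τ) ∘ ℓ·)(z)`), multiplied by `ℓ/θ²`. [folklore] -/
theorem profile_identity {u : ℝ → EuclideanSpace ℝ (Fin 3) → EuclideanSpace ℝ (Fin 3)} {p : ℝ → EuclideanSpace ℝ (Fin 3) → ℝ}
    (hcl : IsClassicalEulerSolutionOn (Iio 0) 0 u p)
    {θ ℓ : ℝ → ℝ} {V : EuclideanSpace ℝ (Fin 3) → EuclideanSpace ℝ (Fin 3)}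
    (hpos : ∀ τ : ℝ, τ < 0 → 0 < θ τ ∧ 0 < ℓ τ) (hθd : DifferentiableOn ℝ θ (Iio 0)) (hℓd : DifferentiableOn ℝ ℓ (Iio 0))
    (hu : ∀ τ : ℝ, τ < 0 → ∀ y, u τ y = θ τ • V ((ℓ τ)⁻¹ • y)) (hV : Differentiable ℝ V)
    {τ : ℝ} (hτ : τ < 0) (z : EuclideanSpace ℝ (Fin 3)) :
    (deriv θ τ * ℓ τ / θ τ ^ 2) • V z + (-(deriv ℓ τ / θ τ)) • fderiv ℝ V z z + fderiv ℝ V z (V z) =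
      gradient (fun y => (-(θ τ ^ 2)⁻¹) * p τ (ℓ τ • y)) z := by
  obtain ⟨hθ, hℓ⟩ := hpos τ hτ
  have hθD : HasDerivAt θ (deriv θ τ) τ := (hθd.differentiableAt (Iio_mem_nhds hτ)).hasDerivAt
  have hℓD : HasDerivAt ℓ (deriv ℓ τ) τ := (hℓd.differentiableAt (Iio_mem_nhds hτ)).hasDerivAt
  have hzx : (ℓ τ)⁻¹ • (ℓ τ • z) = z := inv_smul_smul₀ hℓ.ne' z
  -- ### the time derivative of the ansatz at the point `ℓ z`
  have hT : timeDerivWithin (Iio 0) u τ (ℓ τ • z) =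
      deriv θ τ • V z + (-(θ τ * deriv ℓ τ / ℓ τ)) • fderiv ℝ V z z := by
    rw [timeDerivWithin_apply, derivWithin_of_isOpen isOpen_Iio hτ]
    have h_arg : HasDerivAt (fun s : ℝ => (ℓ s)⁻¹ • (ℓ τ • z)) ((-deriv ℓ τ / ℓ τ ^ 2) • (ℓ τ • z)) τ :=
      (hℓD.inv hℓ.ne').smul_const (ℓ τ • z)
    have h_V : HasDerivAt (fun s : ℝ => V ((ℓ s)⁻¹ • (ℓ τ • z)))
        (fderiv ℝ V ((ℓ τ)⁻¹ • (ℓ τ • z)) ((-deriv ℓ τ / ℓ τ ^ 2) • (ℓ τ • z))) τ :=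
      (hV _).hasFDerivAt.comp_hasDerivAt τ h_arg
    have h_all : HasDerivAt (fun s : ℝ => θ s • V ((ℓ s)⁻¹ • (ℓ τ • z)))
        (θ τ • fderiv ℝ V ((ℓ τ)⁻¹ • (ℓ τ • z)) ((-deriv ℓ τ / ℓ τ ^ 2) • (ℓ τ • z)) +
          deriv θ τ • V ((ℓ τ)⁻¹ • (ℓ τ • z))) τ := hθD.smul h_V
    have h_ev : (fun s : ℝ => u s (ℓ τ • z)) =ᶠ[𝓝 τ] fun s : ℝ => θ s • V ((ℓ s)⁻¹ • (ℓ τ • z)) := by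
      filter_upwards [Iio_mem_nhds hτ] with s hs
      exact hu s hs (ℓ τ • z)
    rw [(h_all.congr_of_eventuallyEq h_ev).deriv, hzx, smul_smul, map_smul, smul_smul, add_comm]
    have hs : θ τ * (-deriv ℓ τ / ℓ τ ^ 2 * ℓ τ) = -(θ τ * deriv ℓ τ / ℓ τ) := by
      field_simp
    rw [hs]
  -- ### the convective term
  have hC : convect (u τ) (u τ) (ℓ τ • z) = (θ τ ^ 2 / ℓ τ) • fderiv ℝ V z (V z) := by
    have hfun : u τ = fun y => θ τ • V ((ℓ τ)⁻¹ • y) := funext (hu τ hτ)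
    rw [convect_apply, hu τ hτ (ℓ τ • z), hfun, fderiv_const_smul_comp_smul_apply, hzx,
      _root_.smul_apply, map_smul, smul_smul]
    congr 1
    ring
  -- ### the pressure term
  have hpd : DifferentiableAt ℝ (fun y => p τ (ℓ τ • y)) z :=
    (((hcl.contDiff_pressure hτ).differentiable (by simp)).differentiableAt).comp z
      ((differentiableAt_id).const_smul (ℓ τ))
  have hP : gradient (p τ) (ℓ τ • z) = (ℓ τ)⁻¹ • gradient (fun y => p τ (ℓ τ • y)) z := by
    rw [gradient_comp_smul, inv_smul_smul₀ hℓ.ne']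
  -- ### momentum at `(τ, ℓ z)`, scaled by `ℓ/θ²`
  have hmom := hcl.momentum τ hτ (ℓ τ • z)
  simp only [Pi.zero_apply, add_zero, zero_smul, zero_sub] at hmom
  rw [hT, hC, hP] at hmom
  have hsc := congrArg (fun w => (ℓ τ / θ τ ^ 2) • w) hmom
  simp only [smul_add, smul_neg, smul_smul] at hsc
  have c1 : ℓ τ / θ τ ^ 2 * deriv θ τ = deriv θ τ * ℓ τ / θ τ ^ 2 := by ring
  have c2 : ℓ τ / θ τ ^ 2 * -(θ τ * deriv ℓ τ / ℓ τ) = -(deriv ℓ τ / θ τ) := by field_simp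
  have c3 : ℓ τ / θ τ ^ 2 * (θ τ ^ 2 / ℓ τ) = 1 := by field_simp
  have c4 : ℓ τ / θ τ ^ 2 * (ℓ τ)⁻¹ = (θ τ ^ 2)⁻¹ := by field_simp
  rw [c1, c2, c3, c4, one_smul, ← neg_smul] at hsc
  rw [gradient_const_mul' hpd]
  exact hsc

/-! ### The stub: clock rigidity -/

/-- **CLOCK RIGIDITY** (`Sig.stub_clockRigidity` of the line `logtime-breathers`, unfolded).  Let `0 < ρ ≤ ½` and let `(u, p, H, c)` carry the
weak-gradient and three-gauge hypotheses of the crux `PowerGaugeEulerLiouville` on the past slab.  If `(u, p)` is a CLASSICAL Euler solution on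
`(−∞, 0) × ℝ³` and SHAPE-PRESERVING — `u(τ, y) = θ(τ) V(y/ℓ(τ))` for all `τ < 0` with positive clocks `θ, ℓ` differentiable on `(−∞,0)` — then
`u` is a log-time breather (`∃ c ≠ 0, W`: `u(τ,y) = e^{cτ} W(e^{−cτ}y)`), or a power clock about some `T₀ ≥ 0` (`u(τ,y) = (T₀−τ)^{γ−1} W((T₀−τ)^{−γ}y)`),
or steady on the past (`u(τ) = v`).  Proof: `profile_identity` + the dichotomy "profile coefficients frozen / not frozen"; frozen ⇒ `clock_trichotomy`
(part 1) with `W = m V(L⁻¹·)`; not frozen ⇒ `slice_eq_zero_of_degenerate` (part 2) ⇒ `u(τ) = 0` for all `τ < 0` (steady, `v = 0`). [folklore] -/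
theorem clockRigidity_of_classical_shapePreserving {ρ : ℝ} (hρ : 0 < ρ) (hρ2 : ρ ≤ 1 / 2)
    {u : ℝ → EuclideanSpace ℝ (Fin 3) → EuclideanSpace ℝ (Fin 3)} {p : ℝ → EuclideanSpace ℝ (Fin 3) → ℝ}
    {H : ℝ → EuclideanSpace ℝ (Fin 3) → EuclideanSpace ℝ (Fin 3) →L[ℝ] EuclideanSpace ℝ (Fin 3)} {c : ℝ≥0}
    (hH : HasWeakSpatialGradientOn (slab (EuclideanSpace ℝ (Fin 3)) (Iio 0) isOpen_Iio) u H)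
    (hgauge : ∀ a : ℝ, 0 < a →
      ENNReal.ofReal (a ^ (2 * ρ)) * cknA a (0 : ℝ × EuclideanSpace ℝ (Fin 3)) u +
          ENNReal.ofReal (a ^ ρ) * cknE a (0 : ℝ × EuclideanSpace ℝ (Fin 3)) H +
        ENNReal.ofReal (a ^ (2 * ρ)) * cknD a (0 : ℝ × EuclideanSpace ℝ (Fin 3)) p ≤ (c : ℝ≥0∞))
    (hcl : IsClassicalEulerSolutionOn (Iio 0) 0 u p)
    (hshape : ∃ (θ ℓ : ℝ → ℝ) (V : EuclideanSpace ℝ (Fin 3) → EuclideanSpace ℝ (Fin 3)),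
      (∀ τ : ℝ, τ < 0 → 0 < θ τ ∧ 0 < ℓ τ) ∧ DifferentiableOn ℝ θ (Iio 0) ∧ DifferentiableOn ℝ ℓ (Iio 0) ∧
        ∀ τ : ℝ, τ < 0 → ∀ y : EuclideanSpace ℝ (Fin 3), u τ y = θ τ • V ((ℓ τ)⁻¹ • y)) :
    (∃ (c' : ℝ) (W : EuclideanSpace ℝ (Fin 3) → EuclideanSpace ℝ (Fin 3)), c' ≠ 0 ∧
        ∀ τ : ℝ, τ < 0 → ∀ y : EuclideanSpace ℝ (Fin 3), u τ y = Real.exp (c' * τ) • W (Real.exp (-(c' * τ)) • y)) ∨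
      (∃ (T₀ γ : ℝ) (W : EuclideanSpace ℝ (Fin 3) → EuclideanSpace ℝ (Fin 3)), 0 ≤ T₀ ∧
        ∀ τ : ℝ, τ < 0 → ∀ y : EuclideanSpace ℝ (Fin 3), u τ y = (T₀ - τ) ^ (γ - 1) • W ((T₀ - τ) ^ (-γ) • y)) ∨
      (∃ v : EuclideanSpace ℝ (Fin 3) → EuclideanSpace ℝ (Fin 3), ∀ τ : ℝ, τ < 0 → u τ = v) := by
  obtain ⟨θ, ℓ, V, hpos, hθd, hℓd, hu⟩ := hshape
  have hA : ∀ a : ℝ, 0 < a → ENNReal.ofReal (a ^ (2 * ρ)) *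
      cknA a (0 : ℝ × EuclideanSpace ℝ (Fin 3)) u ≤ (c : ℝ≥0∞) :=
    fun a ha => le_trans (le_trans le_self_add le_self_add) (hgauge a ha)
  have hE : ∀ a : ℝ, 0 < a → ENNReal.ofReal (a ^ ρ) *
      cknE a (0 : ℝ × EuclideanSpace ℝ (Fin 3)) H ≤ (c : ℝ≥0∞) :=
    fun a ha => le_trans (le_trans le_add_self le_self_add) (hgauge a ha)
  -- ### the profile is smooth
  have h1 : (-1 : ℝ) < 0 := by norm_num
  obtain ⟨hθ1, hℓ1⟩ := hpos (-1) h1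
  have hVeq : V = fun z => (θ (-1))⁻¹ • u (-1) (ℓ (-1) • z) := by
    funext z
    rw [hu (-1) h1 (ℓ (-1) • z), inv_smul_smul₀ hℓ1.ne', inv_smul_smul₀ hθ1.ne']
  have hV : ContDiff ℝ 2 V := by
    rw [hVeq]
    exact (((hcl.contDiff_velocity h1).of_le (by norm_cast)).comp (contDiff_const_smul (ℓ (-1)))).const_smul _
  have hVd : Differentiable ℝ V := hV.differentiable (by norm_num)
  have hprof := fun (τ : ℝ) (hτ : τ < 0) (z : EuclideanSpace ℝ (Fin 3)) =>
    profile_identity hcl hpos hθd hℓd hu hVd hτ z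
  -- ### dichotomy: are the profile coefficients frozen in time?
  by_cases hconst : ∀ τ₁ τ₂ : ℝ, τ₁ < 0 → τ₂ < 0 →
      deriv θ τ₁ * ℓ τ₁ / θ τ₁ ^ 2 = deriv θ τ₂ * ℓ τ₂ / θ τ₂ ^ 2 ∧ deriv ℓ τ₁ / θ τ₁ = deriv ℓ τ₂ / θ τ₂
  · -- #### frozen coefficients: the clock ODEs
    have hθ' : ∀ τ : ℝ, τ < 0 → deriv θ τ = (deriv θ (-1) * ℓ (-1) / θ (-1) ^ 2) * θ τ ^ 2 / ℓ τ := by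
      intro τ hτ
      obtain ⟨hθτ, hℓτ⟩ := hpos τ hτ
      have e := (hconst τ (-1) hτ h1).1
      calc deriv θ τ = (deriv θ τ * ℓ τ / θ τ ^ 2) * θ τ ^ 2 / ℓ τ := by field_simp
        _ = _ := by rw [e]
    have hℓ' : ∀ τ : ℝ, τ < 0 → deriv ℓ τ = (deriv ℓ (-1) / θ (-1)) * θ τ := by
      intro τ hτ
      obtain ⟨hθτ, hℓτ⟩ := hpos τ hτ
      have e := (hconst τ (-1) hτ h1).2
      calc deriv ℓ τ = deriv ℓ τ / θ τ * θ τ := by field_simp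
        _ = _ := by rw [e]
    rcases clock_trichotomy hpos hθd hℓd hθ' hℓ' with
      ⟨c', m, L, hc', hm, hL, hexp⟩ | ⟨T₀, γ, m, L, hT₀, hm, hL, hpow⟩ | ⟨θ₀, ℓ₀, hst⟩
    · -- breather
      refine Or.inl ⟨c', fun w => m • V (L⁻¹ • w), hc', fun τ hτ y => ?_⟩
      rw [hu τ hτ y, (hexp τ hτ).1, (hexp τ hτ).2,
        show (L * Real.exp (c' * τ))⁻¹ • y = L⁻¹ • (Real.exp (-(c' * τ)) • y) by
          rw [mul_inv, Real.exp_neg, mul_smul],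
        mul_comm m, mul_smul]
    · -- power clock
      refine Or.inr (Or.inl ⟨T₀, γ, fun w => m • V (L⁻¹ • w), hT₀, fun τ hτ y => ?_⟩)
      have hTτ : 0 ≤ T₀ - τ := by linarith
      rw [hu τ hτ y, (hpow τ hτ).1, (hpow τ hτ).2,
        show (L * (T₀ - τ) ^ γ)⁻¹ • y = L⁻¹ • ((T₀ - τ) ^ (-γ) • y) by
          rw [mul_inv, ← Real.rpow_neg hTτ, mul_smul],
        mul_comm m, mul_smul]
    · -- steady
      exact Or.inr (Or.inr ⟨fun y => θ₀ • V (ℓ₀⁻¹ • y), fun τ hτ => funext fun y => by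
        rw [hu τ hτ y, (hst τ hτ).1, (hst τ hτ).2]⟩)
  · -- #### moving coefficients: a degenerate relation, the member vanishes on the past
    push Not at hconst
    obtain ⟨τ₁, τ₂, hτ₁, hτ₂, hne⟩ := hconst
    have hab : deriv θ τ₁ * ℓ τ₁ / θ τ₁ ^ 2 - deriv θ τ₂ * ℓ τ₂ / θ τ₂ ^ 2 ≠ 0 ∨
        -(deriv ℓ τ₁ / θ τ₁) - -(deriv ℓ τ₂ / θ τ₂) ≠ 0 := by
      by_contra h
      push Not at h
      exact hne (sub_eq_zero.1 h.1) (by linarith [h.2])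
    -- the two pressure profiles and their difference
    have hq : ∀ σ : ℝ, σ < 0 → ContDiff ℝ 2 fun y : EuclideanSpace ℝ (Fin 3) => (-(θ σ ^ 2)⁻¹) * p σ (ℓ σ • y) := by
      intro σ hσ
      exact contDiff_const.mul (((hcl.contDiff_pressure hσ).of_le (by norm_cast)).comp (contDiff_const_smul (ℓ σ)))
    have hQ : ContDiff ℝ 2 fun y : EuclideanSpace ℝ (Fin 3) =>
        (-(θ τ₁ ^ 2)⁻¹) * p τ₁ (ℓ τ₁ • y) - (-(θ τ₂ ^ 2)⁻¹) * p τ₂ (ℓ τ₂ • y) := (hq τ₁ hτ₁).sub (hq τ₂ hτ₂)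
    have hrel : ∀ z, (deriv θ τ₁ * ℓ τ₁ / θ τ₁ ^ 2 - deriv θ τ₂ * ℓ τ₂ / θ τ₂ ^ 2) • V z +
        (-(deriv ℓ τ₁ / θ τ₁) - -(deriv ℓ τ₂ / θ τ₂)) • fderiv ℝ V z z =
        gradient (fun y : EuclideanSpace ℝ (Fin 3) =>
          (-(θ τ₁ ^ 2)⁻¹) * p τ₁ (ℓ τ₁ • y) - (-(θ τ₂ ^ 2)⁻¹) * p τ₂ (ℓ τ₂ • y)) z := by
      intro z
      have hd1 : DifferentiableAt ℝ (fun y : EuclideanSpace ℝ (Fin 3) => (-(θ τ₁ ^ 2)⁻¹) * p τ₁ (ℓ τ₁ • y)) z :=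
        ((hq τ₁ hτ₁).differentiable (by norm_num)).differentiableAt
      have hd2 : DifferentiableAt ℝ (fun y : EuclideanSpace ℝ (Fin 3) => (-(θ τ₂ ^ 2)⁻¹) * p τ₂ (ℓ τ₂ • y)) z :=
        ((hq τ₂ hτ₂).differentiable (by norm_num)).differentiableAt
      have hgs : gradient (fun y : EuclideanSpace ℝ (Fin 3) =>
          (-(θ τ₁ ^ 2)⁻¹) * p τ₁ (ℓ τ₁ • y) - (-(θ τ₂ ^ 2)⁻¹) * p τ₂ (ℓ τ₂ • y)) z =
          gradient (fun y : EuclideanSpace ℝ (Fin 3) => (-(θ τ₁ ^ 2)⁻¹) * p τ₁ (ℓ τ₁ • y)) z -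
            gradient (fun y : EuclideanSpace ℝ (Fin 3) => (-(θ τ₂ ^ 2)⁻¹) * p τ₂ (ℓ τ₂ • y)) z := by
        unfold gradient
        rw [fderiv_fun_sub hd1 hd2, map_sub]
      rw [hgs]
      linear_combination (norm := module) hprof τ₁ hτ₁ z - hprof τ₂ hτ₂ z
    have hzero : ∀ τ : ℝ, τ < 0 → u τ = 0 := fun τ hτ =>
      slice_eq_zero_of_degenerate hρ hρ2 hH hcl hA hE hpos hθd hℓd hu hV hQ hab hrel hτ
    exact Or.inr (Or.inr ⟨0, hzero⟩)

end ClockRigidity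

end Summit.NavierStokesRegularity.NavierStokesRegularity.Theorems.PowerGaugeEulerLiouville

end
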